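import Summits.CriticalPhenomena.CardyFormulaZ2.Theorems.CardyComplexConeParafermionToSLESixFamiliesDiamondDefs
import Summits.CriticalPhenomena.CardyFormulaZ2.Theorems.CardyComplexConeEdgePrecompactVertexRelation
import Literature.Probability.LatticeModels.InnerFacesHoleFree
import HarnessLib

/-!
# Exact potential pairs of the closed spin-`1/3` corner form (part (E) of S1 `stub_exactPotentialTrace`)

Line `potential-darboux-picard-diamond` of crux `ParafermionToSLESixFamilies` (stmt-CriticalPhenomena-11389), route
`CardyComplexCone`. This file proves the registered helper

`exists_isExactPair : ∀ D E, E.Ω = D.carrier → E.IsZdAdmissible → ∃ Φ Ψ, IsExactPair E E.δ Φ Ψ`,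

the existence clause (E) of `ExactPotentialTrace` (S1) for ONE admissible discretisation of a Jordan (Dobrushin) domain,
and its family form `eventually_exists_isExactPair` (literally the first conjunct of `ExactPotentialTrace` along an
admissible family `IsFamily D Λ`). No definitions are introduced (pure proof file): the corner form, the dictated
increments and the extended form enter the lemmas as variables with defining hypotheses.

## Proof

The corner form `β(v, f) := classWeight (f − v) · cornerObs E E.δ v f` on the coded corners `q = (v, k)`,
`f = cFace q = faceAt v k` (weights `1, i, −1, −i` for `k = 0, 1, 2, 3`), is CLOSED around every lattice edge
`{x, x + e_k}` both of whose faces are inner and both of whose endpoints lie off the discrete arcs: with these weights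
the closedness identity `IsCornerClosedAt` is `classWeight (−cornerOff k)` times the landed half-Cauchy–Riemann vertex
relation `cornerObs_vertexRelation` (`χ = i`; `cornerForm_closedAt`). To integrate it with the tree's discrete
Poincaré lemma `exists_potential_of_holeFree` on the finite hole-free set of inner faces (`holeFree_innerFaces`,
Jordan curve theorem) one needs closedness around EVERY interior edge of that face set, including the edges with an
endpoint on a discrete arc, where the vertex relation is not available (and `IsExactPair` does not constrain the
corners). We therefore EXTEND the form across arc-site corners (`exists_cornerExtension`): an arc site `v` lies on
`zdBoundary`, so some face `faceAt v j₀` around it is not inner (`not_mem_zdBoundary_of_forall_isInnerFace`); going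
around `v` away from that face we give the three remaining steps exactly the increments dictated by the closedness
equations of the three other edges at `v` (read off the `β`-values at the far endpoint if it is off the arcs, and `0`
if it is an arc site too — each per-vertex increment belongs to exactly one edge, so these choices never conflict), the
fourth equation (edge `e_{j₀}`, bordering the non-inner face) never being required. The extended form is closed on the
inner faces (`cornerExtension_closedAt`), the complexified Poincaré lemma (`exists_complexPotential_of_holeFree`, real
and imaginary parts) integrates it, and at non-arc corners the potential pair is an exact pair of `β`.
-/

noncomputable section

namespace Summit.CriticalPhenomena.CardyFormulaZ2.Cruxes.ParafermionToSLESixFamilies.PotentialDarbouxPicardDiamond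

open scoped Topology BigOperators
open Filter Set Complex
open Literature.Probability Literature.Probability.LatticeModels Literature.Probability.Percolation
open Literature.Probability.LatticeModels.DiscreteDobrushin
open Literature.Probability.RandomPlanarGeometry
open Summit.CriticalPhenomena.CardyFormulaZ2.Cruxes.EdgePrecompact.QkzStripBoundaryArm
  (cornerObs cornerObs_vertexRelation not_mem_zdBoundary_of_forall_isInnerFace)
open Summit.CriticalPhenomena.CardyFormulaZ2.Cruxes.ParafermionToSLESixFamilies.IicTraceFluxPairing (IsFamily)

/-! ## `Fin 4` bookkeeping -/

/-- `j + m - j = m` in `Fin 4`. -/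
theorem fin4_add_sub_cancel (j m : Fin 4) : j + m - j = m := by revert j m; decide

/-- `j + m + 3 - j = m + 3` in `Fin 4`. -/
theorem fin4_add_add_three_sub (j m : Fin 4) : j + m + 3 - j = m + 3 := by revert j m; decide

/-! ## The complexified discrete Poincaré lemma -/

/-- **Discrete Poincaré lemma, complex coefficients.** A complex corner form closed on a finite hole-free face set
`P` — around every edge `e_k` at `u` both of whose faces `faceAt u k`, `faceAt u (k + 3)` lie in `P`,
`ω (u, k) + ω (u + e_k, k + 2) = ω (u + e_k, k + 1) + ω (u, k + 3)` (the complex-valued twin of `IsCornerClosedOn`) —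
has a complex potential pair (`exists_potential_of_holeFree` applied to the real and imaginary parts). -/
theorem exists_complexPotential_of_holeFree (ω : Site 2 × Fin 4 → ℂ) (P : Finset (Site 2))
    (hP : HoleFree (↑P : Set (Site 2)))
    (hω : ∀ (u : Site 2) (k : Fin 4), faceAt u k ∈ (↑P : Set (Site 2)) → faceAt u (k + 3) ∈ (↑P : Set (Site 2)) →
      ω (u, k) + ω (u + cornerUnit k, k + 2) = ω (u + cornerUnit k, k + 1) + ω (u, k + 3)) :
    ∃ Hw Hb : Site 2 → ℂ, ∀ q ∈ faceSetCorners (↑P : Set (Site 2)), Hb (cFace q) - Hw q.1 = ω q := by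
  have hre : IsCornerClosedOn (fun q => (ω q).re) ↑P := by
    intro u k h1 h2
    have h := congrArg Complex.re (hω u k h1 h2)
    simpa [IsCornerClosedAt] using h
  have him : IsCornerClosedOn (fun q => (ω q).im) ↑P := by
    intro u k h1 h2
    have h := congrArg Complex.im (hω u k h1 h2)
    simpa [IsCornerClosedAt] using h
  obtain ⟨Hw₁, Hb₁, h₁⟩ := exists_potential_of_holeFree _ P hP hre
  obtain ⟨Hw₂, Hb₂, h₂⟩ := exists_potential_of_holeFree _ P hP him
  refine ⟨fun v => (Hw₁ v : ℂ) + Hw₂ v * I, fun f => (Hb₁ f : ℂ) + Hb₂ f * I, fun q hq => ?_⟩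
  have e₁ := h₁ q hq
  have e₂ := h₂ q hq
  apply Complex.ext
  · simp only [sub_re, add_re, ofReal_re, mul_re, I_re, I_im, ofReal_im, mul_zero, mul_one, sub_zero, add_zero]
    exact e₁
  · simp only [sub_im, add_im, ofReal_im, mul_im, I_re, I_im, ofReal_re, mul_zero, mul_one, zero_add, add_zero]
    exact e₂

/-! ## The class weights on coded corners -/

/-- `classWeight (−cornerOff 0) = 1`. -/
theorem classWeight_neg_cornerOff_zero : classWeight (-cornerOff 0) = 1 := by
  simp [classWeight, cornerOff]

/-- `classWeight (−cornerOff 1) = i`. -/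
theorem classWeight_neg_cornerOff_one : classWeight (-cornerOff 1) = I := by
  have hne1 : (-(Pi.single 0 1 : Site 2)) ≠ 0 := by
    intro h; have := congr_fun h 0; simp at this
  simp [classWeight, cornerOff, hne1]

/-- `classWeight (−cornerOff 2) = −1`. -/
theorem classWeight_neg_cornerOff_two : classWeight (-cornerOff 2) = -1 := by
  have hne2 : (-(Pi.single 0 1 : Site 2) - Pi.single 1 1) ≠ 0 := by
    intro h; have := congr_fun h 0; simp at this
  have hne3 : (-(Pi.single 0 1 : Site 2) - Pi.single 1 1) ≠ -(Pi.single 0 1 : Site 2) := by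
    intro h; have := congr_fun h 1; simp at this
  have e : -cornerOff 2 = (-(Pi.single 0 1 : Site 2) - Pi.single 1 1) := by
    simp only [cornerOff]; abel
  rw [e]
  simp [classWeight, hne2, hne3]

/-- `classWeight (−cornerOff 3) = −i`. -/
theorem classWeight_neg_cornerOff_three : classWeight (-cornerOff 3) = -I := by
  have hne4 : (-(Pi.single 1 1 : Site 2)) ≠ 0 := by
    intro h; have := congr_fun h 1; simp at this
  have hne5 : (-(Pi.single 1 1 : Site 2)) ≠ -(Pi.single 0 1 : Site 2) := by
    intro h; have := congr_fun h 1; simp at this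
  have hne6 : (-(Pi.single 1 1 : Site 2)) ≠ -(Pi.single 0 1 : Site 2) - Pi.single 1 1 := by
    intro h; have := congr_fun h 0; simp at this
  simp [classWeight, cornerOff, hne4, hne5, hne6]

/-- Turning to the next face around a vertex multiplies the class weight by `i`. -/
theorem classWeight_neg_cornerOff_succ (k : Fin 4) :
    classWeight (-cornerOff (k + 1)) = I * classWeight (-cornerOff k) := by
  fin_cases k <;> simp [classWeight_neg_cornerOff_zero, classWeight_neg_cornerOff_one, classWeight_neg_cornerOff_two,
    classWeight_neg_cornerOff_three]

/-- Two faces further: the weight changes sign. -/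
theorem classWeight_neg_cornerOff_add_two (k : Fin 4) :
    classWeight (-cornerOff (k + 2)) = -classWeight (-cornerOff k) := by
  rw [← fin4_add_one_add_one, classWeight_neg_cornerOff_succ, classWeight_neg_cornerOff_succ, ← mul_assoc, I_mul_I,
    neg_one_mul]

/-- Three faces further: the weight is multiplied by `−i`. -/
theorem classWeight_neg_cornerOff_add_three (k : Fin 4) :
    classWeight (-cornerOff (k + 3)) = -(I * classWeight (-cornerOff k)) := by
  rw [← fin4_add_two_add_one, classWeight_neg_cornerOff_succ, classWeight_neg_cornerOff_add_two, mul_neg]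

/-! ## The corner form and its closedness off the arcs -/

/-- **The vertex relation in corner coordinates.** For the discretisation of a Jordan Dobrushin domain, admissible,
and an edge `{x, x + e_k}` with both endpoints off the discrete arcs and both faces `faceAt x k`, `faceAt x (k + 3)`
inner: `E(x, k) − E(x + e_k, k + 2) = i (E(x + e_k, k + 1) − E(x, k + 3))` (`cornerObs_vertexRelation` at
`p = (x, k + 3)`). -/
theorem cornerObs_closedAt (D : DobrushinDomain) {E : DiscreteDobrushin} (hΩ : E.Ω = D.carrier)
    (hE : E.IsZdAdmissible) {x : Site 2} {k : Fin 4} (hxA : x ∉ E.zdArcA) (hxB : x ∉ E.zdArcB)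
    (hyA : x + cornerUnit k ∉ E.zdArcA) (hyB : x + cornerUnit k ∉ E.zdArcB) (h₁ : E.IsInnerFace (faceAt x k))
    (h₂ : E.IsInnerFace (faceAt x (k + 3))) :
    cornerObs E E.δ x (faceAt x k) - cornerObs E E.δ (x + cornerUnit k) (faceAt (x + cornerUnit k) (k + 2)) =
      I * (cornerObs E E.δ (x + cornerUnit k) (faceAt (x + cornerUnit k) (k + 1)) -
        cornerObs E E.δ x (faceAt x (k + 3))) := by
  have hT : cTgt ((x, k + 3) : Site 2 × Fin 4) = s(x, x + cornerUnit k) := by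
    simp only [cTgt, fin4_add_three_add_one]
  have he : cTgt ((x, k + 3) : Site 2 × Fin 4) ∈ (discreteDomainGraph E.Ω E.δ).edgeSet := by
    rw [hT]; exact adj_of_isInnerFace_faceAt h₁ (Or.inl rfl)
  have hAB : ∀ y ∈ cTgt ((x, k + 3) : Site 2 × Fin 4), y ∉ E.zdArcA ∧ y ∉ E.zdArcB := by
    rw [hT]
    intro y hy
    rcases Sym2.mem_iff.1 hy with rfl | rfl
    · exact ⟨hxA, hxB⟩
    · exact ⟨hyA, hyB⟩
  have hin₂ : E.IsInnerFace (faceAt ((x, k + 3) : Site 2 × Fin 4).1 (((x, k + 3) : Site 2 × Fin 4).2 + 1)) := by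
    show E.IsInnerFace (faceAt x (k + 3 + 1))
    rw [fin4_add_three_add_one]; exact h₁
  have key := cornerObs_vertexRelation D hΩ hE (p := (x, k + 3)) he hAB h₂ hin₂
  simpa only [cFace, cornerPartner, fin4_add_three_add_one, fin4_three_two, fin4_add_three_add_three] using key

/-- **Closedness of the corner form off the arcs**: the corner form `β(v, k) = classWeight (f − v) · cornerObs E E.δ v f`,
`f = cFace (v, k)` (entering as the variable `β` with its defining hypothesis), satisfies the closedness identity around
an edge with both endpoints off the discrete arcs and both faces inner (the vertex relation times
`classWeight (−cornerOff k)`). -/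
theorem cornerForm_closedAt (D : DobrushinDomain) {E : DiscreteDobrushin} (hΩ : E.Ω = D.carrier)
    (hE : E.IsZdAdmissible) {β : Site 2 × Fin 4 → ℂ}
    (hβ : ∀ q, β q = classWeight (cFace q - q.1) * cornerObs E E.δ q.1 (cFace q)) {x : Site 2} {k : Fin 4}
    (hxA : x ∉ E.zdArcA) (hxB : x ∉ E.zdArcB) (hyA : x + cornerUnit k ∉ E.zdArcA) (hyB : x + cornerUnit k ∉ E.zdArcB)
    (h₁ : E.IsInnerFace (faceAt x k)) (h₂ : E.IsInnerFace (faceAt x (k + 3))) :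
    β (x, k) + β (x + cornerUnit k, k + 2) = β (x + cornerUnit k, k + 1) + β (x, k + 3) := by
  have VR := cornerObs_closedAt D hΩ hE hxA hxB hyA hyB h₁ h₂
  have e : ∀ (v : Site 2) (j : Fin 4), faceAt v j - v = -cornerOff j := fun v j => sub_sub_cancel_left v (cornerOff j)
  simp only [hβ, cFace, e, classWeight_neg_cornerOff_succ, classWeight_neg_cornerOff_add_two,
    classWeight_neg_cornerOff_add_three]
  linear_combination classWeight (-cornerOff k) * VR

/-! ## Extension of a corner form across a set of sites -/

/-- **Extending a corner form across the sites of `S` with prescribed increments.** Given a corner form `β`, a set of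
sites `S` each of which corners some face outside `P` (`hj`), and arbitrary increments `Δ v c`, there is a corner form
`ω` equal to `β` at the corners of sites off `S` and having, at every site `v ∈ S`, the increment
`ω (v, c) − ω (v, c + 3) = Δ v c` across every edge `e_c` whose face `faceAt v c` lies in `P`: going around `v` away
from a non-`P` face `faceAt v j₀`, take the partial sums of the `Δ`'s (the step back into `faceAt v j₀` is free). -/
theorem exists_cornerExtension (S P : Set (Site 2)) (β : Site 2 × Fin 4 → ℂ) (Δ : Site 2 → Fin 4 → ℂ)
    (hj : ∀ v ∈ S, ∃ j : Fin 4, faceAt v j ∉ P) :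
    ∃ ω : Site 2 × Fin 4 → ℂ, (∀ q, q.1 ∉ S → ω q = β q) ∧
      ∀ v ∈ S, ∀ c : Fin 4, faceAt v c ∈ P → ω (v, c) - ω (v, c + 3) = Δ v c := by
  classical
  choose! j₀ hj₀ using hj
  refine ⟨fun q => if q.1 ∈ S then
      ![0, Δ q.1 (j₀ q.1 + 1), Δ q.1 (j₀ q.1 + 1) + Δ q.1 (j₀ q.1 + 2),
        Δ q.1 (j₀ q.1 + 1) + Δ q.1 (j₀ q.1 + 2) + Δ q.1 (j₀ q.1 + 3)] (q.2 - j₀ q.1)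
    else β q, fun q hq => by simp [hq], fun v hv c hc => ?_⟩
  have hne : c ≠ j₀ v := fun h => hj₀ v hv (h ▸ hc)
  simp only [hv, if_true]
  obtain ⟨m, rfl⟩ : ∃ m, c = j₀ v + m := ⟨c - j₀ v, by abel⟩
  rw [fin4_add_sub_cancel, fin4_add_add_three_sub]
  fin_cases m
  · simp at hne
  · simp
  · simp
  · simp

/-- **The extended form is closed.** Let `β` be closed around every edge with both endpoints off `S` and both faces in
`P` (`hβ`), let `ω` agree with `β` off `S` (`hωβ`) and have at the sites of `S` the increments DICTATED by closedness
(`hωS` with `hΔS`, `hΔβ`: across the edge `e_c` at `v ∈ S`, the difference of the two `β`-values at the far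
endpoint `v + e_c` if it is off `S`, else `0`). Then `ω` is closed around every edge with both faces in `P`. -/
theorem cornerExtension_closedAt {S P : Set (Site 2)} {β ω : Site 2 × Fin 4 → ℂ} {Δ : Site 2 → Fin 4 → ℂ}
    (hΔS : ∀ v c, v + cornerUnit c ∈ S → Δ v c = 0)
    (hΔβ : ∀ v c, v + cornerUnit c ∉ S → Δ v c = β (v + cornerUnit c, c + 1) - β (v + cornerUnit c, c + 2))
    (hωβ : ∀ q, q.1 ∉ S → ω q = β q)
    (hωS : ∀ v ∈ S, ∀ c : Fin 4, faceAt v c ∈ P → ω (v, c) - ω (v, c + 3) = Δ v c)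
    (hβ : ∀ (u : Site 2) (k : Fin 4), u ∉ S → u + cornerUnit k ∉ S → faceAt u k ∈ P → faceAt u (k + 3) ∈ P →
      β (u, k) + β (u + cornerUnit k, k + 2) = β (u + cornerUnit k, k + 1) + β (u, k + 3))
    {u : Site 2} {k : Fin 4} (h₁ : faceAt u k ∈ P) (h₂ : faceAt u (k + 3) ∈ P) :
    ω (u, k) + ω (u + cornerUnit k, k + 2) = ω (u + cornerUnit k, k + 1) + ω (u, k + 3) := by
  have h₂' : faceAt (u + cornerUnit k) (k + 2) ∈ P := by rw [faceAt_add_unit_add_two]; exact h₂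
  have hback : u + cornerUnit k + cornerUnit (k + 2) = u := by rw [cornerUnit_add_two]; abel
  by_cases hu : u ∈ S
  · have L := hωS u hu k h₁
    by_cases hu' : u + cornerUnit k ∈ S
    · have R := hωS _ hu' (k + 2) h₂'
      rw [fin4_add_two_add_three] at R
      have hL0 : Δ u k = 0 := hΔS u k hu'
      have hR0 : Δ (u + cornerUnit k) (k + 2) = 0 := hΔS _ _ (by rw [hback]; exact hu)
      rw [hL0] at L
      rw [hR0] at R
      linear_combination L + R
    · have hL : Δ u k = β (u + cornerUnit k, k + 1) - β (u + cornerUnit k, k + 2) := hΔβ u k hu'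
      rw [hωβ (u + cornerUnit k, k + 2) hu', hωβ (u + cornerUnit k, k + 1) hu']
      rw [hL] at L
      linear_combination L
  · by_cases hu' : u + cornerUnit k ∈ S
    · have R := hωS _ hu' (k + 2) h₂'
      rw [fin4_add_two_add_three] at R
      have hR : Δ (u + cornerUnit k) (k + 2) = β (u, k + 3) - β (u, k) := by
        rw [hΔβ _ _ (by rw [hback]; exact hu), hback, fin4_add_two_add_one, fin4_add_two_add_two']
      rw [hωβ (u, k) hu, hωβ (u, k + 3) hu]
      rw [hR] at R
      linear_combination R
    · rw [hωβ (u, k) hu, hωβ (u, k + 3) hu, hωβ (u + cornerUnit k, k + 2) hu', hωβ (u + cornerUnit k, k + 1) hu']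
      exact hβ u k hu hu' h₁ h₂

/-! ## The registered helper: exact pairs exist -/

/-- **(E) of S1 — exact potential pairs exist.** For the discretisation `E` of a (Jordan) Dobrushin domain `D`
(`E.Ω = D.carrier`), `ℤ²`-admissible, there is an exact potential pair `(Φ, Ψ)` of the closed spin-`1/3` corner form:
`Φ v − Ψ f = classWeight (f − v) · cornerObs E E.δ v f` at every corner `(v, f)` of an inner face `f` with `v` off both
discrete arcs. Proof: the corner form extended across the arc sites (`exists_cornerExtension`; every arc site corners
a non-inner face, `not_mem_zdBoundary_of_forall_isInnerFace`) is closed on the finite hole-free set of inner faces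
(`cornerExtension_closedAt`, `cornerForm_closedAt`, `holeFree_innerFaces`), so the discrete Poincaré lemma integrates
it (`exists_complexPotential_of_holeFree`). -/
theorem exists_isExactPair : ∀ (D : DobrushinDomain) (E : DiscreteDobrushin), E.Ω = D.carrier → E.IsZdAdmissible → ∃ Φ Ψ : Site 2 → ℂ, IsExactPair E E.δ Φ Ψ := by
  intro D E hΩ hE
  classical
  set S : Set (Site 2) := E.zdArcA ∪ E.zdArcB with hS
  set P : Set (Site 2) := {f | E.IsInnerFace f} with hP
  set β : Site 2 × Fin 4 → ℂ := fun q => classWeight (cFace q - q.1) * cornerObs E E.δ q.1 (cFace q) with hβ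
  set Δ : Site 2 → Fin 4 → ℂ := fun v c =>
    if v + cornerUnit c ∈ S then 0 else β (v + cornerUnit c, c + 1) - β (v + cornerUnit c, c + 2) with hΔ
  have hj : ∀ v ∈ S, ∃ j : Fin 4, faceAt v j ∉ P := by
    intro v hv
    by_contra h
    push Not at h
    have hvb : v ∈ E.zdBoundary := by
      rcases hv with hv | hv
      · exact E.zdArcA_subset_zdBoundary hv
      · exact E.zdArcB_subset_zdBoundary hv
    exact not_mem_zdBoundary_of_forall_isInnerFace h hvb
  obtain ⟨ω, hωβ, hωS⟩ := exists_cornerExtension S P β Δ hj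
  have hclosed : ∀ (u : Site 2) (k : Fin 4), faceAt u k ∈ P → faceAt u (k + 3) ∈ P →
      ω (u, k) + ω (u + cornerUnit k, k + 2) = ω (u + cornerUnit k, k + 1) + ω (u, k + 3) :=
    fun u k h₁ h₂ => cornerExtension_closedAt (fun v c h => by simp only [hΔ]; rw [if_pos h])
      (fun v c h => by simp only [hΔ]; rw [if_neg h]) hωβ hωS
      (fun u k hu hu' h₁ h₂ => cornerForm_closedAt D hΩ hE (fun q => by rw [hβ]) (fun h => hu (Or.inl h))
        (fun h => hu (Or.inr h)) (fun h => hu' (Or.inl h)) (fun h => hu' (Or.inr h)) h₁ h₂) h₁ h₂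
  have hfin : P.Finite := finite_hasAllSides hE.isBounded hE.delta_pos
  have hcoe : (↑hfin.toFinset : Set (Site 2)) = P := hfin.coe_toFinset
  have hHF : HoleFree (↑hfin.toFinset : Set (Site 2)) := by
    rw [hcoe]; exact holeFree_innerFaces D.toJordanDomain hΩ hE.delta_pos
  obtain ⟨Hw, Hb, hpot⟩ := exists_complexPotential_of_holeFree ω _ hHF fun u k hu₁ hu₂ => by
    rw [hcoe] at hu₁ hu₂
    exact hclosed u k hu₁ hu₂
  refine ⟨fun v => -Hw v, fun f => -Hb f, ?_⟩
  intro v f hc hf hvA hvB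
  obtain ⟨k, rfl⟩ := exists_faceAt_of_isCorner hc
  have hq : ((v, k) : Site 2 × Fin 4) ∈ faceSetCorners (↑hfin.toFinset : Set (Site 2)) := by
    rw [mem_faceSetCorners, hcoe]; exact hf
  have key := hpot (v, k) hq
  have hv : v ∉ S := fun h => h.elim hvA hvB
  rw [hωβ (v, k) hv] at key
  simp only [hβ, cFace] at key
  linear_combination key

/-- **(E) along a family** — literally the first conjunct of `ExactPotentialTrace`: along an admissible
discretisation family `Λ` of `D` (`IsFamily`: `(Λ δ).Ω = D.carrier`, `(Λ δ).δ = δ`, eventually admissible), eventually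
in `δ` an exact potential pair of `Λ δ` at mesh `δ` exists. -/
theorem eventually_exists_isExactPair (D : DobrushinDomain) (Λ : ℝ → DiscreteDobrushin) (hΛ : IsFamily D Λ) :
    ∀ᶠ δ in 𝓝[>] (0:ℝ), ∃ Φ Ψ : Site 2 → ℂ, IsExactPair (Λ δ) δ Φ Ψ :=
  hΛ.2.2.2.2.2.mono fun δ hδ => by
    obtain ⟨Φ, Ψ, h⟩ := exists_isExactPair D (Λ δ) (hΛ.1 δ) hδ
    rw [hΛ.2.1 δ] at h
    exact ⟨Φ, Ψ, h⟩

end Summit.CriticalPhenomena.CardyFormulaZ2.Cruxes.ParafermionToSLESixFamilies.PotentialDarbouxPicardDiamond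

end
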